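/-
Copyright: cell pub-balaban-gaps (YM BLITZ Y1, track G1), seat g1-p2 GEN 8 (unit `pub-balaban-gaps-g1-p2`).  Row (D4) NODE O,
OBJECT ∕ MECHANISM level, CARRIER-GENERIC: [B9] Cor. 3.5's step for the covariant shift `V_W` under LEVEL-DEPENDENT windows —
print's (3.37) «|A′| < α₁(L^jη)^{−1}, |∇A′| < α₁(L^jη)^{−2} on Ω_j» and (3.61) «|(V′λ)(x)| ≦ O(1)α₁((L^jη)^{−1}|∇_Uλ| + (L^jη)^{−2}|λ|)»
carry a SITE WEIGHT `w(x) = (L^{j(x)}η)^{−1}`: the bond window is `ηα·w(x)`, the divergence window `η²α′·w(x)²`, and the kernel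
letters that pay for them are the WEIGHTED ones `‖w²·G‖`, `‖w·∂G‖` ((3.42): «O(1)[(L^jη)², (L^jη)]»).  This file regroups the SAME
operator `V_W` of `D4WalkBlockShiftAlgebra` along the weighted family `{w², w·∂_μ, w·S⁻_μ∂_μ}` with UNIFORMLY bounded cube-local
coefficients and runs 55's perturbation step — constants uniform; the top-scale window of `D4WalkBlockShiftStep` is the case `w ≡ 1`.
HONEST FRAMING: elementary; nothing of Bałaban's constructed; (D4) NOT discharged (instance 0∕1); NOT BetaPertH, NOT continuum, NOT Clay.
-/
import Summits.QuantumFields.BalabanUV.Gaps.D4WalkBlockShiftAlgebra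

/-!
# `Gaps.D4WalkBlockShiftWeighted` — the covariant shift under LEVEL-WEIGHTED (3.37)∕(3.61) windows: regrouping along
# `{w², w∂_μ, wS⁻_μ∂_μ}`, the weighted domination letter, and Cor. 3.5's step with weighted kernel letters (carrier-generic;
# cell pub-balaban-gaps, seat g1-p2 gen 8)

HONEST DEPENDENCY (cell pub-balaban, verbatim): continuum YM on T⁴ ⇐ BetaPertH ∧ nine spine estimates (0/9 proved);
BetaPertH ⇐ (D1) ∧ (D4) ∧ CAP+tail.

Data: a finite carrier `X`, fibre `F`, cube map `cub`, shift permutations `sh μ` (inverses move the cube by ≤ 1), scale `η > 0`, and a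
SITE WEIGHT `w : X → ℝ`, `w > 0`, with bounded NEIGHBOUR RATIO `w(x) ≤ Λ·w(sh μ⁻¹ x)` (print: `w = (L^{j(x)}η)^{−1}`, levels of
neighbours differ by ≤ 1 by (2.2), so `Λ = L`).
* §1 `fibD_mul` (site-local coefficients multiply pointwise), the weight operator `wOp w = fibD (w·1_F)`, `wOp_mul_fibD`;
* §2 the weighted family `covDopW` = {`wOp w²`, `wOp w·Dfw μ`, `wOp w·Sbw μ·Dfw μ`} (index `Unit ⊕ ι ⊕ ι`), letters `covBW ρ Λ` =
  {1, 1, Λe^{ρ}}, coefficients `covCoeffW` (`η⁻²w⁻²Σ(W⁺+W⁻)`, `η⁻¹w⁻¹W⁺`, `−η⁻¹w⁻¹W⁻`), **`covShift_eq_weighted`** (`V_W = Σ_j ã_j·D̃_j` —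
  the same matrix); **`covShiftW_dominated`**: WEIGHTED windows `Σ_b‖W^±_μ(u,x)_{ab}‖ ≤ ηα·w(x)`, `Σ_b‖(Σ_μW⁺+W⁻)(u,x)_{ab}‖ ≤ η²α′·w(x)²`
  ⟹ `‖V_W(u)S‖_{Y,Y′} ≤ 0·‖S‖ + α′‖w²S‖ + Σ_μ α(‖w∂_μS‖ + ‖wS⁻_μ∂_μS‖)` (cube-restricted norms);
* §3 `blockNorm_wOp_relab_mul_le` (a weighted letter survives the one-cube relabelling at the price `Λe^{ρ}`),
  **`blockWalkExpansion_covShiftW_of_letters`** — COR. 3.5's STEP UNDER LEVEL-WEIGHTED WINDOWS: for any kernel `G` with the value letter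
  `‖G‖ ≤ Ce^{−ρd₁}` and the WEIGHTED letters `‖w²G‖ ≤ Ce^{−ρd₁}`, `‖w∂_μG‖ ≤ Ce^{−ρd₁}`: `G(1 − V_W(u)G)⁻¹` is a block walk expansion with the
  relative letters `covBW ρ Λ` for the weighted family — margin `c_μ(c_μ·1·(1·((0 + α′ + Σ_μ α(1 + Λe^{ρ}))C))c_μ)c_μ < 1`, NO weight in any
  constant.
WHAT IT IS NOT.  An instance (the nested-family instance with `w = L^{k−lev}` is `D4WalkBlockCovariantWeightedMultiLevel`); Bałaban's
`U′`; (D4) instance 0∕1; words of row (D4) UNCHANGED.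

References: T. Bałaban, Comm. Math. Phys. **99** (1985) 389–434 [B9], (3.37) p. 396, Thm 3.1 (3.42) p. 397, (3.50)–(3.54) pp. 400–401,
(3.61) p. 402, Cor. 3.5 p. 407; Comm. Math. Phys. **96** (1984) [4], (2.2) p. 224, Prop. 2.2 (2.67) p. 234.
-/

noncomputable section

namespace Summit.QuantumFields.BalabanUV.Gaps.D4WalkBlockShiftWeighted

open Metric Set Finset
open scoped Matrix
open Literature.MathematicalPhysics.QuantumFieldTheory.Balaban1983to89
open Literature.MathematicalPhysics.QuantumFieldTheory.Balaban1983to89.B9SectDWalk (DomBy)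
open Literature.MathematicalPhysics.QuantumFieldTheory.Balaban1983to89.B9Thm34Ext (toB6)
open Literature.MathematicalPhysics.QuantumFieldTheory.Balaban1983to89.B9Thm37GlueTorus (torusGeom tdist1 tdist1_nonneg tdist1_comm
  tdist1_triangle)
open Literature.MathematicalPhysics.QuantumFieldTheory.Balaban1983to89.TreeLengthTorus (TPt)
open Literature.MathematicalPhysics.QuantumFieldTheory.Balaban1983to89.B5TorusCover (UT)
open Literature.MathematicalPhysics.QuantumFieldTheory.Balaban1983to89.B11SectG (RowSum)
open Summit.QuantumFields.BalabanUV.Gaps.D4WalkBlock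
  (rowMass blockNorm blockNorm_nonneg blockNorm_le_of_rowMass_le rowMass_le_blockNorm BlockWalkExpansion)
open Summit.QuantumFields.BalabanUV.Gaps.D4WalkBlockDerivative
  (blockDominated_of_local differentiableOn_perturb_entry blockWalkExpansion_perturb_of_derivLetters)
open Summit.QuantumFields.BalabanUV.Gaps.D4WalkBlockFlatLetters (blockWalkExpansion_const)
open Summit.QuantumFields.BalabanUV.Gaps.D4WalkBlockShiftAlgebra

variable {X : Type} {F : Type}
variable {ν : ℕ} {Kv : Fin ν → ℕ}

/-! ## §1. Products of site-local coefficients; the weight operator -/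

section Weight
variable (X F) [Fintype X] [Fintype F] [DecidableEq X] [DecidableEq F]

/-- **The weight operator** `w ⊗ 1_F`: multiplication by the site weight `w(x)` (print: `(L^{j(x)}η)^{−1}` and its powers).
[cite: Balaban1985BackgroundPropagators, Thm 3.1 (3.42) p.397, (3.61) p.402] -/
def wOp (w : X → ℝ) : Matrix (X × F) (X × F) ℂ := fibD X F fun x => ((w x : ℝ) : ℂ) • (1 : Matrix F F ℂ)

variable {X F}

omit [DecidableEq F] in
/-- Site-local coefficients multiply pointwise. -/
theorem fibD_mul (a b : X → Matrix F F ℂ) : fibD X F a * fibD X F b = fibD X F fun x => a x * b x := by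
  ext p q
  rw [Matrix.mul_apply]
  unfold fibD
  simp only [Matrix.of_apply]
  by_cases hpq : p.1 = q.1
  · rw [if_pos hpq, Matrix.mul_apply]
    rw [← Finset.sum_subset (Finset.subset_univ (Finset.univ.filter (fun r : X × F => r.1 = p.1)))]
    · rw [show (Finset.univ.filter (fun r : X × F => r.1 = p.1)) = (Finset.univ : Finset F).map ⟨fun b => (p.1, b), fun b b' h => by
          simpa using h⟩ from by
            ext r; simp only [Finset.mem_filter, Finset.mem_univ, true_and, Finset.mem_map, Function.Embedding.coeFn_mk]
            constructor
            · intro h; exact ⟨r.2, by rw [← h]⟩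
            · rintro ⟨b, rfl⟩; rfl,
        Finset.sum_map]
      refine Finset.sum_congr rfl fun b _ => ?_
      simp only [Function.Embedding.coeFn_mk, if_true, hpq]
    · intro r _ hr
      simp only [Finset.mem_filter, Finset.mem_univ, true_and] at hr
      have : ¬ p.1 = r.1 := fun h => hr h.symm
      rw [if_neg this, zero_mul]
  · rw [if_neg hpq]
    refine Finset.sum_eq_zero fun r _ => ?_
    by_cases h1 : p.1 = r.1
    · have h2 : ¬ r.1 = q.1 := fun h => hpq (h1.trans h)
      rw [if_neg h2, mul_zero]
    · rw [if_neg h1, zero_mul]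

/-- `(w ⊗ 1)·fibD a = fibD (w·a)`. -/
theorem wOp_mul_fibD (w : X → ℝ) (a : X → Matrix F F ℂ) :
    wOp X F w * fibD X F a = fibD X F fun x => ((w x : ℝ) : ℂ) • a x := by
  unfold wOp; rw [fibD_mul]; congr 1; funext x; rw [Matrix.smul_mul, Matrix.one_mul]

/-- `fibD a·(w ⊗ 1) = fibD (w·a)` (the weight is central among site-local coefficients). -/
theorem fibD_mul_wOp (w : X → ℝ) (a : X → Matrix F F ℂ) :
    fibD X F a * wOp X F w = fibD X F fun x => ((w x : ℝ) : ℂ) • a x := by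
  unfold wOp; rw [fibD_mul]; congr 1; funext x; rw [Matrix.mul_smul, Matrix.mul_one]

/-- Rows of `(w ⊗ 1)·M` are the rows of `M` scaled by `w(x)`. -/
theorem wOp_mul_apply (w : X → ℝ) (M : Matrix (X × F) (X × F) ℂ) (p q : X × F) :
    (wOp X F w * M) p q = ((w p.1 : ℝ) : ℂ) * M p q := by
  classical
  unfold wOp fibD
  rw [Matrix.mul_apply]
  have : ∀ r : X × F, (Matrix.of (fun p q : X × F => if p.1 = q.1 then (((w p.1 : ℝ) : ℂ) • (1 : Matrix F F ℂ)) p.2 q.2 else 0)) p r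
      * M r q = if r = p then ((w p.1 : ℝ) : ℂ) * M p q else 0 := by
    intro r
    simp only [Matrix.of_apply, Matrix.smul_apply, Matrix.one_apply, smul_eq_mul]
    by_cases h : r = p
    · subst h; simp
    · rw [if_neg h]
      by_cases h1 : p.1 = r.1
      · have h2 : p.2 ≠ r.2 := fun h2 => h (Prod.ext h1.symm h2.symm)
        rw [if_pos h1, if_neg h2, mul_zero, zero_mul]
      · rw [if_neg h1, zero_mul]
  simp_rw [this]
  rw [Finset.sum_ite_eq' Finset.univ p]; simp

end Weight

/-! ## §2. The weighted regrouping of `V_W` and its domination letter -/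

section Weighted
variable (X F) [Fintype X] [Fintype F] [DecidableEq X] [DecidableEq F] {ι : Type} [Fintype ι] (sh : ι → X ≃ X) (η : ℝ)
variable (w : X → ℝ)
variable {E : Type*} [NormedAddCommGroup E] [NormedSpace ℂ E]

/-- The WEIGHTED operator family `{w², w·∂_μ, w·S⁻_μ∂_μ}` (print's `(L^jη)^{−2}|λ|`, `(L^jη)^{−1}|∇λ|` of (3.61)). -/
def covDopW : Unit ⊕ (ι ⊕ ι) → Matrix (X × F) (X × F) ℂ
  | Sum.inl _ => wOp X F (fun x => w x ^ 2)
  | Sum.inr (Sum.inl μ) => wOp X F w * Dfw X F sh η μ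
  | Sum.inr (Sum.inr μ) => wOp X F w * (Sbw X F sh μ * Dfw X F sh η μ)

/-- The relative letters of the weighted family at walk rate `ρ` and neighbour ratio `Λ`: `{1, 1, Λe^{ρ}}`. -/
def covBW (ρ Λ : ℝ) : Unit ⊕ (ι ⊕ ι) → ℝ
  | Sum.inl _ => 1
  | Sum.inr (Sum.inl _) => 1
  | Sum.inr (Sum.inr _) => Λ * Real.exp ρ

variable (Wp Wm : ι → E → X → Matrix F F ℂ)

/-- The WEIGHTED coefficients: `η⁻²w⁻²Σ_μ(W⁺+W⁻)`, `η⁻¹w⁻¹W⁺_μ`, `−η⁻¹w⁻¹W⁻_μ` — uniformly bounded under the level-dependent windows. -/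
def covCoeffW : Unit ⊕ (ι ⊕ ι) → E → Matrix (X × F) (X × F) ℂ
  | Sum.inl _ => fun u => fibD X F fun x => (((η : ℂ)⁻¹) ^ 2 * (((w x ^ 2)⁻¹ : ℝ) : ℂ)) • ∑ μ, (Wp μ u x + Wm μ u x)
  | Sum.inr (Sum.inl μ) => fun u => fibD X F fun x => (((η : ℂ)⁻¹) * (((w x)⁻¹ : ℝ) : ℂ)) • Wp μ u x
  | Sum.inr (Sum.inr μ) => fun u => fibD X F fun x => (-(((η : ℂ)⁻¹) * (((w x)⁻¹ : ℝ) : ℂ))) • Wm μ u x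

/-- The domination weights of the family: `α′` on `w²`, `α` on each `w∂_μ`, `wS⁻_μ∂_μ`. -/
def covAlphaW (α α' : ℝ) : Unit ⊕ (ι ⊕ ι) → ℝ
  | Sum.inl _ => α'
  | Sum.inr _ => α

variable {X F sh η w Wp Wm}

omit [Fintype X] [Fintype F] [DecidableEq F] [NormedAddCommGroup E] [NormedSpace ℂ E] in
/-- unfolding of the weighted divergence coefficient. -/
theorem covCoeffW_zero (v : Unit) (u : E) : covCoeffW X F η w Wp Wm (Sum.inl v) u =
    fibD X F fun x => (((η : ℂ)⁻¹) ^ 2 * (((w x ^ 2)⁻¹ : ℝ) : ℂ)) • ∑ μ, (Wp μ u x + Wm μ u x) := rfl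

omit [Fintype X] [Fintype F] [DecidableEq F] [NormedAddCommGroup E] [NormedSpace ℂ E] in
/-- unfolding of the weighted forward coefficient. -/
theorem covCoeffW_fwd (μ : ι) (u : E) : covCoeffW X F η w Wp Wm (Sum.inr (Sum.inl μ)) u =
    fibD X F fun x => (((η : ℂ)⁻¹) * (((w x)⁻¹ : ℝ) : ℂ)) • Wp μ u x := rfl

omit [Fintype X] [Fintype F] [DecidableEq F] [NormedAddCommGroup E] [NormedSpace ℂ E] in
/-- unfolding of the weighted backward coefficient. -/
theorem covCoeffW_bwd (μ : ι) (u : E) : covCoeffW X F η w Wp Wm (Sum.inr (Sum.inr μ)) u =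
    fibD X F fun x => (-(((η : ℂ)⁻¹) * (((w x)⁻¹ : ℝ) : ℂ))) • Wm μ u x := rfl

omit [NormedAddCommGroup E] [NormedSpace ℂ E] in
/-- **`V_W = Σ_j ã_j·D̃_j`** — the weighted regrouping is the SAME matrix (`w > 0`). -/
theorem covShift_eq_weighted (hw : ∀ x, 0 < w x) (u : E) :
    covShift X F sh η Wp Wm u = ∑ j, covCoeffW X F η w Wp Wm j u * covDopW X F sh η w j := by
  rw [Fintype.sum_sum_type, Fintype.sum_sum_type, Finset.univ_unique, Finset.sum_singleton]
  unfold covShift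
  rw [Fintype.sum_sum_type]
  have h0 : covCoeff₀ X F η Wp Wm u = covCoeffW X F η w Wp Wm (Sum.inl default) u * covDopW X F sh η w (Sum.inl default) := by
    show _ = fibD X F _ * wOp X F _
    rw [fibD_mul_wOp]
    unfold covCoeff₀
    congr 1; funext x
    rw [smul_smul]
    congr 1
    have hx : ((w x : ℝ) : ℂ) ≠ 0 := by exact_mod_cast (hw x).ne'
    push_cast
    field_simp
  have h1 : ∀ μ, covCoeff X F η Wp Wm (Sum.inl μ) u * covDop X F sh η (Sum.inl μ) =
      covCoeffW X F η w Wp Wm (Sum.inr (Sum.inl μ)) u * covDopW X F sh η w (Sum.inr (Sum.inl μ)) := by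
    intro μ
    show fibD X F _ * Dfw X F sh η μ = fibD X F _ * (wOp X F w * Dfw X F sh η μ)
    rw [← Matrix.mul_assoc, fibD_mul_wOp]
    congr 2; funext x
    rw [smul_smul]; congr 1
    have hx : ((w x : ℝ) : ℂ) ≠ 0 := by exact_mod_cast (hw x).ne'
    push_cast
    field_simp
  have h2 : ∀ μ, covCoeff X F η Wp Wm (Sum.inr μ) u * covDop X F sh η (Sum.inr μ) =
      covCoeffW X F η w Wp Wm (Sum.inr (Sum.inr μ)) u * covDopW X F sh η w (Sum.inr (Sum.inr μ)) := by
    intro μ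
    show fibD X F _ * (Sbw X F sh μ * Dfw X F sh η μ) = fibD X F _ * (wOp X F w * (Sbw X F sh μ * Dfw X F sh η μ))
    rw [← Matrix.mul_assoc (fibD X F _) (wOp X F w), fibD_mul_wOp]
    congr 2; funext x
    rw [smul_smul]; congr 1
    have hx : ((w x : ℝ) : ℂ) ≠ 0 := by exact_mod_cast (hw x).ne'
    push_cast
    field_simp
  rw [h0]
  simp_rw [h1, h2]

omit [DecidableEq F] in
/-- the fibre row masses of a scaled family. -/
private theorem sum_norm_smul_le {v : Matrix F F ℂ} (c : ℂ) {β : ℝ} (a : F) (h : ∑ b, ‖v a b‖ ≤ β) :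
    ∑ b, ‖(c • v) a b‖ ≤ ‖c‖ * β := by
  calc ∑ b, ‖(c • v) a b‖ = ‖c‖ * ∑ b, ‖v a b‖ := by
        rw [Finset.mul_sum]; exact Finset.sum_congr rfl fun b _ => by rw [Matrix.smul_apply, smul_eq_mul, norm_mul]
    _ ≤ ‖c‖ * β := mul_le_mul_of_nonneg_left h (norm_nonneg c)

omit [NormedSpace ℂ E] in
/-- **THE WEIGHTED (3.61)-SHAPE DOMINATION LETTER.**  LEVEL-DEPENDENT windows — BOND `Σ_b‖W^±_μ(u,x)_{ab}‖ ≤ ηα·w(x)`, DIVERGENCE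
`Σ_b‖(Σ_μW⁺_μ + W⁻_μ)(u,x)_{ab}‖ ≤ η²α′·w(x)²` (`η, w > 0`) ⟹ for every `S`:
`‖V_W(u)S‖_{Y,Y′} ≤ 0·‖S‖_{Y,Y′} + Σ_j covAlphaW_j·‖D̃_jS‖_{Y,Y′}` — print's «(L^jη)^{−1}|∇_Uλ| + (L^jη)^{−2}|λ|» with `w = (L^jη)^{−1}`.
[cite: Balaban1985BackgroundPropagators, (3.61) p.402, (3.54) p.401, (3.37) p.396] -/
theorem covShiftW_dominated [∀ i, NeZero (Kv i)] (cub : X → UT Kv) (hη : 0 < η) (hw : ∀ x, 0 < w x) {R α α' : ℝ} (hα : 0 ≤ α)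
    (hα' : 0 ≤ α')
    (hWp : ∀ μ, ∀ u ∈ ball (0 : E) R, ∀ x a, ∑ b, ‖Wp μ u x a b‖ ≤ η * α * w x)
    (hWm : ∀ μ, ∀ u ∈ ball (0 : E) R, ∀ x a, ∑ b, ‖Wm μ u x a b‖ ≤ η * α * w x)
    (hdiv : ∀ u ∈ ball (0 : E) R, ∀ x a, ∑ b, ‖(∑ μ, (Wp μ u x + Wm μ u x)) a b‖ ≤ η ^ 2 * α' * w x ^ 2) :
    ∀ u ∈ ball (0 : E) R, ∀ (S : Matrix (X × F) (X × F) ℂ) (Y Y' : UT Kv),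
      blockNorm (fun p : X × F => cub p.1) (fun p : X × F => cub p.1) (covShift X F sh η Wp Wm u * S) Y Y' ≤
        0 * blockNorm (fun p : X × F => cub p.1) (fun p : X × F => cub p.1) S Y Y' +
          ∑ j, covAlphaW α α' j * blockNorm (fun p : X × F => cub p.1) (fun p : X × F => cub p.1) (covDopW X F sh η w j * S) Y Y' := by
  intro u hu S Y Y'
  rw [covShift_eq_weighted hw u, ← zero_add (∑ j, covCoeffW X F η w Wp Wm j u * covDopW X F sh η w j)]
  have hnη : ‖((η : ℂ)⁻¹)‖ = η⁻¹ := by rw [norm_inv, Complex.norm_real, Real.norm_eq_abs, abs_of_pos hη]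
  have hnw : ∀ x, ‖((((w x)⁻¹ : ℝ)) : ℂ)‖ = (w x)⁻¹ := fun x => by
    rw [Complex.norm_real, Real.norm_eq_abs, abs_of_pos (inv_pos.2 (hw x))]
  have hnw2 : ∀ x, ‖((((w x ^ 2)⁻¹ : ℝ)) : ℂ)‖ = (w x ^ 2)⁻¹ := fun x => by
    rw [Complex.norm_real, Real.norm_eq_abs, abs_of_pos (inv_pos.2 (pow_pos (hw x) 2))]
  refine blockDominated_of_local (fun p : X × F => cub p.1) (fun p : X × F => cub p.1) (covDopW X F sh η w)
    (0 : Matrix (X × F) (X × F) ℂ) (fun j => covCoeffW X F η w Wp Wm j u) (α₀ := 0) (α := covAlphaW α α')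
    (fun i k h => (h rfl).elim) (fun Y => by rw [D4WalkBlockDerivative.blockNorm_zero]) (fun j p q h => ?_) (fun j Y => ?_) S Y Y'
  · rcases j with v | (μ | μ)
    · rw [covCoeffW_zero] at h; exact fibD_local cub _ p q h
    · rw [covCoeffW_fwd] at h; exact fibD_local cub _ p q h
    · rw [covCoeffW_bwd] at h; exact fibD_local cub _ p q h
  · have hη0 : η ≠ 0 := hη.ne'
    rcases j with v | (μ | μ)
    · rw [covCoeffW_zero]
      refine blockNorm_fibD_le cub _ hα' (fun x a => ?_) Y
      have hw0 : w x ≠ 0 := (hw x).ne'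
      calc _ ≤ ‖((η : ℂ)⁻¹) ^ 2 * ((((w x ^ 2)⁻¹ : ℝ)) : ℂ)‖ * (η ^ 2 * α' * w x ^ 2) := sum_norm_smul_le _ a (hdiv u hu x a)
        _ = α' := by rw [norm_mul, norm_pow, hnη, hnw2 x]; field_simp
    · rw [covCoeffW_fwd]
      refine blockNorm_fibD_le cub _ hα (fun x a => ?_) Y
      have hw0 : w x ≠ 0 := (hw x).ne'
      calc _ ≤ ‖((η : ℂ)⁻¹) * ((((w x)⁻¹ : ℝ)) : ℂ)‖ * (η * α * w x) := sum_norm_smul_le _ a (hWp μ u hu x a)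
        _ = α := by rw [norm_mul, hnη, hnw x]; field_simp
    · rw [covCoeffW_bwd]
      refine blockNorm_fibD_le cub _ hα (fun x a => ?_) Y
      have hw0 : w x ≠ 0 := (hw x).ne'
      calc _ ≤ ‖-(((η : ℂ)⁻¹) * ((((w x)⁻¹ : ℝ)) : ℂ))‖ * (η * α * w x) := sum_norm_smul_le _ a (hWm μ u hu x a)
        _ = α := by rw [norm_neg, norm_mul, hnη, hnw x]; field_simp

end Weighted

/-! ## §3. Cor. 3.5's step under level-weighted windows -/

section Step
variable [Fintype X] [Fintype F] [DecidableEq X] [DecidableEq F] {ι : Type} [Fintype ι] {sh : ι → X ≃ X} {η : ℝ} {w : X → ℝ}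
variable [∀ i, NeZero (Kv i)]
variable {dd N' : ℕ} {E : Type*} [NormedAddCommGroup E] [NormedSpace ℂ E]

omit [Fintype ι] [NormedAddCommGroup E] [NormedSpace ℂ E] in
/-- **A WEIGHTED LETTER SURVIVES THE ONE-CUBE RELABELLING AT THE PRICE `Λe^{ρ}`**: if `σ` moves the cube by at most one, the weight has
neighbour ratio `w(x) ≤ Λ·w(σx)` (`w > 0`, `Λ ≥ 0`) and `‖(w ⊗ 1)M‖_{Y,Y′} ≤ Ae^{−ρd₁}`, then `‖(w ⊗ 1)·relab σ·M‖_{Y,Y′} ≤ ΛAe^{ρ}·e^{−ρd₁}`. -/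
theorem blockNorm_wOp_relab_mul_le (cub : X → UT Kv) (σ : X → X) (hσ : ∀ x, tdist1 Kv (cub (σ x)) (cub x) ≤ 1)
    (hw : ∀ x, 0 < w x) {Λ : ℝ} (hΛ : 0 ≤ Λ) (hwr : ∀ x, w x ≤ Λ * w (σ x)) (M : Matrix (X × F) (X × F) ℂ) {A ρ : ℝ}
    (hA : 0 ≤ A) (hρ : 0 ≤ ρ)
    (hM : ∀ Y Y', blockNorm (fun p : X × F => cub p.1) (fun p : X × F => cub p.1) (wOp X F w * M) Y Y' ≤
      A * Real.exp (-(ρ * tdist1 Kv Y Y')))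
    (Y Y' : UT Kv) :
    blockNorm (fun p : X × F => cub p.1) (fun p : X × F => cub p.1) (wOp X F w * (relab X F σ * M)) Y Y' ≤
      (Λ * A * Real.exp ρ) * Real.exp (-(ρ * tdist1 Kv Y Y')) := by
  refine blockNorm_le_of_rowMass_le _ _ _ Y Y' (by positivity) fun p hp => ?_
  -- the row of `(w ⊗ 1)·relab σ·M` at `p` is `(w(x)/w(σx))` times the row of `(w ⊗ 1)M` at `(σx, a)`
  have hwσ := hw (σ p.1)
  have e : rowMass (fun p : X × F => cub p.1) (wOp X F w * (relab X F σ * M)) p Y' =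
      (w p.1 / w (σ p.1)) * rowMass (fun p : X × F => cub p.1) (wOp X F w * M) (σ p.1, p.2) Y' := by
    unfold rowMass
    rw [Finset.mul_sum]
    refine Finset.sum_congr rfl fun q _ => ?_
    rw [wOp_mul_apply, relab_mul_apply, wOp_mul_apply, norm_mul, norm_mul, Complex.norm_real, Complex.norm_real,
      Real.norm_eq_abs, Real.norm_eq_abs, abs_of_pos (hw p.1), abs_of_pos hwσ]
    field_simp
  rw [e]
  have hratio : w p.1 / w (σ p.1) ≤ Λ := by rw [div_le_iff₀ hwσ]; exact hwr p.1
  set Y'' := cub (σ p.1) with hY''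
  have h1 : tdist1 Kv Y'' Y ≤ 1 := by rw [hY'', ← hp]; exact hσ p.1
  have h2 : tdist1 Kv Y Y' ≤ 1 + tdist1 Kv Y'' Y' := by
    have := tdist1_triangle (N := Kv) Y Y'' Y'
    rw [tdist1_comm Y Y''] at this
    linarith
  have hrow : rowMass (fun p : X × F => cub p.1) (wOp X F w * M) (σ p.1, p.2) Y' ≤ A * Real.exp (-(ρ * tdist1 Kv Y'' Y')) :=
    (rowMass_le_blockNorm _ _ (wOp X F w * M) _ Y').trans (hM Y'' Y')
  calc w p.1 / w (σ p.1) * rowMass (fun p : X × F => cub p.1) (wOp X F w * M) (σ p.1, p.2) Y'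
      ≤ Λ * (A * Real.exp (-(ρ * tdist1 Kv Y'' Y'))) :=
        mul_le_mul hratio hrow (D4WalkBlock.rowMass_nonneg _ _ _ _) hΛ
    _ ≤ (Λ * A * Real.exp ρ) * Real.exp (-(ρ * tdist1 Kv Y Y')) := by
        rw [show Λ * A * Real.exp ρ * Real.exp (-(ρ * tdist1 Kv Y Y')) = Λ * (A * (Real.exp ρ * Real.exp (-(ρ * tdist1 Kv Y Y'))))
          by ring, ← Real.exp_add]
        exact mul_le_mul_of_nonneg_left (mul_le_mul_of_nonneg_left (Real.exp_le_exp.2 (by nlinarith)) hA) hΛ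

/-- **[B9] COR. 3.5's STEP UNDER LEVEL-WEIGHTED WINDOWS ON ANY KERNEL WITH WEIGHTED LETTERS.**  Data: cube map, shifts whose inverses
move the cube by ≤ 1, `η > 0`, weight `w > 0` with neighbour ratio `w(x) ≤ Λ·w(sh μ⁻¹ x)`; a kernel `G` with the value letter
`‖G‖ ≤ Ce^{−ρd₁}` and the WEIGHTED letters `‖(w² ⊗ 1)G‖ ≤ Ce^{−ρd₁}`, `‖(w ⊗ 1)(∂_μ ⊗ 1)G‖ ≤ Ce^{−ρd₁}` (print's (3.42): value `O(1)(L^jη)²`,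
derivative `O(1)(L^jη)`); holomorphic defects with the LEVEL-DEPENDENT windows `ηα·w(x)` (bond), `η²α′·w(x)²` (divergence) (print's
(3.37)); cube row sum `(μ, c_μ)`, `2μ ≤ ε`, `2μ ≤ ρ − ε − μ`, margin
`c_μ(c_μ·1·(1·((0 + Σ_j covAlphaW_j·covBW_j)C))c_μ)c_μ < 1` (`Σ_j … = α′ + |ι|α(1 + Λe^{ρ})`): `G(1 − V_W(u)G)⁻¹` is a block walk expansion
at `(ε − 2μ, ρ − ε − 3μ, c_μC(1·(1−q)⁻¹)c_μ, ρ − 2μ)` with the relative letters `covBW ρ Λ` for the weighted family — NO weight, level or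
`η⁻¹` in any constant. [cite: Balaban1985BackgroundPropagators, Cor. 3.5 p.407, (3.61) p.402, Thm 3.1 (3.42) p.397, (3.37) p.396; Balaban1988RG2Cluster, (1.11) p.5] -/
theorem blockWalkExpansion_covShiftW_of_letters (cub : X → UT Kv) (hη : 0 < η) (hw : ∀ x, 0 < w x) {Λ : ℝ} (hΛ : 0 ≤ Λ)
    (hsh : ∀ μ x, tdist1 Kv (cub ((sh μ).symm x)) (cub x) ≤ 1) (hwr : ∀ μ x, w x ≤ Λ * w ((sh μ).symm x))
    (G : Matrix (X × F) (X × F) ℂ) {C ρ : ℝ} (hC : 0 ≤ C) (hρ : 0 ≤ ρ)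
    (hG : ∀ Y Y', blockNorm (fun p : X × F => cub p.1) (fun p : X × F => cub p.1) G Y Y' ≤ C * Real.exp (-(ρ * tdist1 Kv Y Y')))
    (hGw2 : ∀ Y Y', blockNorm (fun p : X × F => cub p.1) (fun p : X × F => cub p.1) (wOp X F (fun x => w x ^ 2) * G) Y Y' ≤
      C * Real.exp (-(ρ * tdist1 Kv Y Y')))
    (hGw1 : ∀ μ Y Y', blockNorm (fun p : X × F => cub p.1) (fun p : X × F => cub p.1) (wOp X F w * (Dfw X F sh η μ * G)) Y Y' ≤
      C * Real.exp (-(ρ * tdist1 Kv Y Y')))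
    (c₀ : B13.Consts) (Xs : Finset (UT Kv)) (R : ℝ) (Wp Wm : ι → E → X → Matrix F F ℂ) (α α' ε μ cμ : ℝ)
    (hWph : ∀ ν x a b, DifferentiableOn ℂ (fun u => Wp ν u x a b) (ball (0 : E) R))
    (hWmh : ∀ ν x a b, DifferentiableOn ℂ (fun u => Wm ν u x a b) (ball (0 : E) R)) (hα : 0 ≤ α) (hα' : 0 ≤ α')
    (hWp : ∀ ν, ∀ u ∈ ball (0 : E) R, ∀ x a, ∑ b, ‖Wp ν u x a b‖ ≤ η * α * w x)
    (hWm : ∀ ν, ∀ u ∈ ball (0 : E) R, ∀ x a, ∑ b, ‖Wm ν u x a b‖ ≤ η * α * w x)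
    (hdiv : ∀ u ∈ ball (0 : E) R, ∀ x a, ∑ b, ‖(∑ ν, (Wp ν u x + Wm ν u x)) a b‖ ≤ η ^ 2 * α' * w x ^ 2)
    (hμ : 0 ≤ μ) (hμε : 2 * μ ≤ ε) (hμκ : 2 * μ ≤ ρ - ε - μ) (hcμ : 0 ≤ cμ)
    (hrow : RowSum (toB6 (torusGeom Kv 0 0 0) 0 True) μ cμ)
    (hq : cμ * (cμ * 1 * (1 * ((0 + ∑ j : Unit ⊕ (ι ⊕ ι), covAlphaW α α' j * covBW ρ Λ j) * C)) * cμ) * cμ < 1) :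
    ∃ (W : Type) (T : W → (TPt dd N' → ℂ) → E → Matrix (X × F) (X × F) ℂ) (SX' : Set W) (A' : W → ℝ)
      (D' : W → UT Kv → UT Kv → ℝ),
      BlockWalkExpansion c₀ (fun p : X × F => cub p.1) (fun p : X × F => cub p.1)
        (fun (_ : TPt dd N' → ℂ) u => G * (1 - covShift X F sh η Wp Wm u * G)⁻¹) Xs R (ε - 2 * μ) (ρ - ε - μ - 2 * μ)
        (cμ * C * (1 * (1 - cμ * (cμ * 1 * (1 * ((0 + ∑ j : Unit ⊕ (ι ⊕ ι), covAlphaW α α' j * covBW ρ Λ j) * C)) * cμ) * cμ)⁻¹) * cμ)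
        T SX' A' D' (ρ - 2 * μ) ∧
      (∀ (j : Unit ⊕ (ι ⊕ ι)) ω (σ : TPt dd N' → ℂ), (∀ i, ‖σ i‖ ≤ Real.exp c₀.κ₁) → ∀ u ∈ ball (0 : E) R, ∀ Y Y',
        blockNorm (fun p : X × F => cub p.1) (fun p : X × F => cub p.1) (covDopW X F sh η w j * T ω σ u) Y Y' ≤
          covBW (ι := ι) ρ Λ j * (A' ω * Real.exp (-((ρ - 2 * μ) * D' ω Y Y')))) ∧
      ∀ ω, DomBy (toB6 (torusGeom Kv 0 0 0) 0 True) (D' ω) := by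
  have hW := blockWalkExpansion_const (dd := dd) (N' := N') (E := E) c₀ (fun p : X × F => cub p.1) Xs G R
    (ε := ε) (κ := ρ - ε - μ) (ρ := ρ) hC (by linarith) hG
  have hD : ∀ (j : Unit ⊕ (ι ⊕ ι)) (ω : Unit) (σ : TPt dd N' → ℂ), (∀ i, ‖σ i‖ ≤ Real.exp c₀.κ₁) → ∀ u ∈ ball (0 : E) R,
      ∀ Y Y' : UT Kv,
        blockNorm (fun p : X × F => cub p.1) (fun p : X × F => cub p.1) (covDopW X F sh η w j * G) Y Y' ≤
          covBW (ι := ι) ρ Λ j * (C * Real.exp (-(ρ * tdist1 Kv Y Y'))) := by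
    intro j _ σ _ u _ Y Y'
    rcases j with v | (ν' | ν')
    · show blockNorm _ _ (wOp X F (fun x => w x ^ 2) * G) Y Y' ≤ 1 * _
      rw [one_mul]; exact hGw2 Y Y'
    · show blockNorm _ _ (wOp X F w * Dfw X F sh η ν' * G) Y Y' ≤ 1 * _
      rw [one_mul, Matrix.mul_assoc]; exact hGw1 ν' Y Y'
    · show blockNorm _ _ (wOp X F w * (Sbw X F sh ν' * Dfw X F sh η ν') * G) Y Y' ≤ Λ * Real.exp ρ * _
      rw [Matrix.mul_assoc, Matrix.mul_assoc]
      have h := blockNorm_wOp_relab_mul_le (F := F) cub ((sh ν').symm : X → X) (hsh ν') hw hΛ (hwr ν') (Dfw X F sh η ν' * G)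
        hC hρ (fun Y Y' => hGw1 ν' Y Y') Y Y'
      calc _ ≤ _ := h
        _ = _ := by ring
  exact blockWalkExpansion_perturb_of_derivLetters (Dop := covDopW X F sh η w) (B := covBW (ι := ι) ρ Λ) hW (fun _ Y Y' => le_rfl)
    (fun j => by rcases j with _ | (_ | _) <;> simp only [covBW] <;> positivity) hD (covShift_holo hWph hWmh) le_rfl
    (fun j => by rcases j with _ | (_ | _) <;> simp only [covAlphaW] <;> assumption)
    (covShiftW_dominated cub hη hw hα hα' hWp hWm hdiv) hμ hμε hμκ (by linarith) hC hcμ hrow hq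

end Step

end Summit.QuantumFields.BalabanUV.Gaps.D4WalkBlockShiftWeighted

end
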